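import Summits.HodgeConjecture.HodgeConjecture.Theorems.Ring2AbelianAllAndreLerayIdempotentRational
import Summits.HodgeConjecture.HodgeConjecture.Theorems.Ring2AbelianAllAndreFibreInvariantPairing
import Summits.HodgeConjecture.HodgeConjecture.Theorems.Ring2AbelianAllAndreCrossCorrespondence
import HarnessLib

/-!
# Ring 2 · sub-cell AbelianAll (ALL ABELIAN VARIETIES), André axis, part XXVIII-a — WHERE THE LERAY IDEMPOTENT IS FOR FREE:
# lifts of the invariant classes GIVE an algebraic Leray idempotent (dual bases through the fibre), so that in the habitat
# "the invariant classes of the CM fibre are algebraic" the bracket `CMLerayIdempotentC[]` is IMPLIED by (L), and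
# `(L)_t(p) ⟺ [∃ algebraic Leray idempotent with algebraic image]`; the datum does not depend on the point `t`

HONEST FRAMING (page 1, verbatim): **research route, not a corollary; conditional on HC_CM plus one named
minimal statement.** Cell line: research route conditional on HC_CM; not a corollary; Q11.4-sentence-2
already refuted in dim ≥ 3. Nothing in this file proves a case of the Hodge conjecture for an abelian variety; `HC_CM` does not occur in
this file; item `Theses.RankFourFaces.CMToAbelian` (stmt-16267) OPEN and not closed here. Seat `pub-hodge-ring2-ab-andre-2`, gen 20; brief
(ii) "minimise … record each version" and (iii) "attack `B_min` … smallest open instance stated as a find-the-cycle problem".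

## The question left open by part XXVII

Parts XXVII-a…e re-keyed the André-axis weight hypothesis to ONE algebraic cycle per (pencil, CM point `t`, degree `2p ≤ 2d`): an
endomorphism `e` of `H^{2p}(𝒳)` with (Π1) `e` an algebraic correspondence, (π) `j_t^* ∘ e = j_t^*`, (κ) `e|_{ker j_t^*} = 0` (bracket
`CMLerayIdempotentC[]`), supplied by (θ∀), by (β′), by `(Q) ∧ (5)` and by `HodgeConjecture` (for `𝒳 ⊗ 𝒳`), and recorded as NOT shown
necessary: it is a standing hypothesis of BOTH directions of the exactness rows `HC_AV ⟺ HC_CM ∧ CMIdempotentHodgeC[]`.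

## What this file proves (theorems only; no definition, no named fact, no sorry)

§1 `exists_eq_mul_of_forall_eq_zero` — two linear functionals, one of them injective, are proportional (so the trace functional `τ` of
part XIV-a is a multiple of `⟨-, [𝒳(ℂ)]⟩`).
§2 **`exists_lerayIdempotent_of_range_le_map` — LIFTS GIVE THE IDEMPOTENT.** For every smooth projective family `f : 𝒳 ⟶ S` over a smooth
projective base (any dimensions), a point `t` and `p + q = n = dim X_t`: IF (A) every invariant class `j_t^* H^{2p}(𝒳)` is the
restriction of an ALGEBRAIC class of `𝒳`, and (B) every invariant class of `H^{2q}(X_t)` is algebraic ON `X_t`, THEN there is `e` with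
(Π1), (π), (κ) and, moreover, `Im e ⊆ Nᵖ(𝒳)`. Construction: a basis `xᵢ|_{X_t}` of the invariants with `xᵢ ∈ Nᵖ(𝒳)` (A); the dual
functionals, extended to `H^{2p}(X_t)` and represented through Poincaré duality of `X_t(ℂ)` by classes `w̃ᵢ ∈ H^{2q}(X_t)`; their invariant
components `wᵢ` along `H^{2q}(X_t) = Im j_t^* ⊕ ker j_{t*}` (part XXVI-a) pair with `Im j_t^*` exactly as `w̃ᵢ` does (`⟨k ∪ j_t^* c, [X_t]⟩ =
⟨j_{t*} k ∪ c, [𝒳]⟩ = 0` for `k ∈ ker j_{t*}`) and are algebraic (B), so `zᵢ = j_{t*} wᵢ ∈ N^{q+m}(𝒳)`; then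
`e(c) = ∑ᵢ ⟨j_{t*} wᵢ ∪ c, [𝒳]⟩ xᵢ = ∑ᵢ ⟨wᵢ ∪ j_t^* c, [X_t]⟩ xᵢ` is induced by the algebraic class `∑ᵢ pr₁^* xᵢ ∪ pr₂^*(c'·zᵢ)` (part
XIV-a `exists_crossTrace`, §1), restricts to `∑ᵢ ψᵢ(j_t^* c) xᵢ|_{X_t} = j_t^* c`, and kills `ker j_t^*`.
§3 `range_le_map_of_exists_lerayIdempotent` (converse, no hypothesis) and **`range_le_map_iff_exists_lerayIdempotent`**: granted (B),
[every invariant class in degree `2p` lifts to an algebraic class] ⟺ [there is an algebraic Leray idempotent at `(t, 2p)` with algebraic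
image]; `forall_mem_algebraicClasses_of_exists_lerayIdempotent` — then EVERY `e'` with (Π1), (κ) at `(t, 2p)` has algebraic image.
§4 **The datum does not depend on the point**: `map_fiberι_eq_zero_iff_of_points` (`ker j_t^* = ker j_s^*`, Deligne's kernel identity,
a tree theorem) and `leray_at_of_at` ((π), (κ) at `t` ⟹ (π), (κ) at every `s`); so "at CM points" in `CMLerayIdempotentC[]` only selects
the pencils.
§5 Compact abelian pencils: `exists_lerayIdempotentC_of_range_le_map`, `comap_le_sup_of_range_le_map` / `range_le_map_of_comap_le_sup`
((L)_t(p) ⟺ (A) when the invariants of degree `2p` are algebraic on `X_t`), and the headline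
**`comap_le_sup_iff_exists_lerayIdempotentC`: at a point where the invariant classes of degrees `2p` and `2q = 2d − 2p` are algebraic on
the fibre, (L)_t(p) ⟺ ∃ `e` with (Π1), (π), (κ) and `Im e ⊆ Nᵖ(𝒳)` ⟺ ∃ `e` with (Π1), (π), (κ) and the fibre-rational Hodge reading of
part XXVII-e** — in this habitat `B_min`(André) at `(t, p)` IS the find-the-cycles statement "an algebraic `(d+1)`-cycle on `𝒳 × 𝒳` acting
on `H^{2p}(𝒳)` as a Leray idempotent, with image spanned by algebraic `p`-cycles", with NO standing bracket.

## Honest status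

No node is born; nothing is minimal; nothing here is fact-free progress on `HC_AV`. The habitat clause "the invariant classes of the CM
fibre are algebraic" is a HYPOTHESIS per (pencil, point, degree) — under `HC_CM` it says that the fixed part `H⁰(S, R^{2a} f_*ℚ)` is of
type `(a,a)` at the CM point; it FAILS for pencils with a constant CM factor (`X_s = B_s × C`, `H^{2,0}(C) ≠ 0`) and HOLDS in the
large-monodromy Weil habitat (W_E)₃ (invariants `ℂκᵃ` off the middle degree, `κ³ ⊕` Weil classes in degree `6`, algebraic on `E⁶` by
Tate). So the idempotent bracket is NOT removed from the general exactness rows; what is shown is WHERE it is for free (part XXVIII-b: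
the restricted bracket `CMLerayIdempotentC[inv]` follows from (L), hence from `HC_AV` modulo Verdier — on-path through abelian varieties
only, whereas the unrestricted bracket needed `HodgeConjecture` for `𝒳 ⊗ 𝒳`, part XXVII-d).

References: Milne2020HodgeClassesAV (proof of Prop. 1, pp. 7–8); DeningerMurre1991 (Thm. 3.1, Cor. 3.2); DeligneHodgeII1971 (Thm. 4.1.1,
Cor. 4.2.8); VoisinHodgeII2003 (§4.3.1 Thm. 4.18, §4.3.3 Thm. 4.24, (10.7), Prop. 9.20–9.21); VoisinHodgeI2002 (§11.3.3 Lemma 11.41);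
FultonYoungTableaux1997 (App. B (5)–(6)); HatcherAT2002 (§3.3 Prop. 3.38); Andre1996Motifs (§5.1, Lemme 6.3.1, Remarque 2).
-/

noncomputable section

set_option linter.dupNamespace false

namespace Summit.HodgeConjecture.HodgeConjecture.Ring2.AbelianAll

open CategoryTheory AlgebraicGeometry
open Literature.AlgebraicGeometry Literature.AlgebraicGeometry.Motives
open Literature.AlgebraicGeometry.HodgeTheory
open Literature.AlgebraicTopology.SingularHomology (cupPairing cupPairing_apply cupPairing_flip cupProduct
  cupProduct_gradedComm_holds isPerfPair_cupPairing_of_field_holds kroneckerPairing)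
open Summit.HodgeConjecture.HodgeConjecture.Theorems (cupPairing_complexGysin_complexOrientationFamily)

/-! ## §1 Two functionals, one injective, are proportional -/

/-- **Linear algebra**: if `τ : V → K` is a linear functional with `τ z = 0 ⟹ z = 0` then every linear functional `ε` on `V` is a
multiple of `τ` (`V` has dimension `≤ 1`; `z = (τ z / τ z₀) • z₀`). Used with `τ` the trace functional of part XIV-a on `H^{2 dim 𝒳}(𝒳(ℂ))`
and `ε = ⟨-, [𝒳(ℂ)]⟩`. [cite: HatcherAT2002, §3.3 Thm. 3.26 and Prop. 3.38] -/
theorem exists_eq_mul_of_forall_eq_zero {K V : Type*} [Field K] [AddCommGroup V] [Module K V] (τ : V →ₗ[K] K)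
    (hτ : ∀ z, τ z = 0 → z = 0) (ε : V →ₗ[K] K) : ∃ c : K, ∀ z, ε z = c * τ z := by
  rcases subsingleton_or_nontrivial V with hV | hV
  · exact ⟨0, fun z ↦ by rw [Subsingleton.elim z 0, map_zero, map_zero, mul_zero]⟩
  · obtain ⟨z₀, hz₀⟩ := exists_ne (0 : V)
    have hτ₀ : τ z₀ ≠ 0 := fun h ↦ hz₀ (hτ z₀ h)
    refine ⟨ε z₀ / τ z₀, fun z ↦ ?_⟩
    have hz : z = (τ z / τ z₀) • z₀ := by
      refine sub_eq_zero.1 (hτ _ ?_)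
      rw [map_sub, map_smul, smul_eq_mul, div_mul_cancel₀ _ hτ₀, sub_self]
    rw [hz, map_smul, map_smul, smul_eq_mul, smul_eq_mul, div_mul_cancel₀ _ hτ₀]
    ring

/-! ## §2 Lifts of the invariant classes give an algebraic Leray idempotent -/

section Family

variable {n m N : ℕ} {𝒳 S : SchemeOver ℂ} {f : 𝒳 ⟶ S}

/-- **LIFTS GIVE THE IDEMPOTENT.** Smooth projective family `f : 𝒳 ⟶ S` of relative dimension `n` over a smooth projective base of
dimension `m`, total space of dimension `N`, a point `t`, `p + q = n`. If (A) `j_t^* H^{2p}(𝒳) ⊆ j_t^* Nᵖ(𝒳)` (every invariant class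
of degree `2p` is the restriction of an algebraic class) and (B) `j_t^* H^{2q}(𝒳) ⊆ N^q(X_t)` (the invariant classes of the
complementary degree are algebraic on the fibre), then there is an endomorphism `e` of `H^{2p}(𝒳(ℂ); ℂ)` induced by an algebraic cycle
on `𝒳 × 𝒳` with `j_t^* ∘ e = j_t^*`, `e|_{ker j_t^*} = 0` and `Im e ⊆ Nᵖ(𝒳)`: `e(c) = ∑ᵢ ⟨wᵢ ∪ j_t^* c, [X_t]⟩ • xᵢ` for algebraic lifts
`xᵢ` of a basis of the invariants and the invariant components `wᵢ` of Poincaré duals of the dual basis (module docstring), induced by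
the algebraic class `∑ᵢ pr₁^* xᵢ ∪ pr₂^*(c' · j_{t*} wᵢ)` (part XIV-a). In print: the Leray / relative Künneth projector written in a basis
of algebraic sections. [cite: Milne2020HodgeClassesAV, proof of Prop. 1 (pp. 7–8)] [cite: DeningerMurre1991, Thm. 3.1 and Cor. 3.2]
[cite: VoisinHodgeII2003, proof of Thm. 10.17 (10.7) and §4.3.3 Thm. 4.24] [cite: FultonYoungTableaux1997, Appendix B §B.1 (5)–(6)] -/
theorem exists_lerayIdempotent_of_range_le_map (hS : IsSmoothProjective m S) (hf : IsSmoothProjectiveFamily f n)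
    (h𝒳 : IsSmoothProjective N 𝒳) (t : ComplexPoints S) {p q : ℕ} (hpq : p + q = n)
    (hA : LinearMap.range (complexBetti.map (fiberι f t) (2 * p)).hom ≤
      (algebraicClasses 𝒳 p).map (complexBetti.map (fiberι f t) (2 * p)).hom)
    (hB : LinearMap.range (complexBetti.map (fiberι f t) (2 * q)).hom ≤ algebraicClasses (fiberOver f t) q) :
    ∃ e : complexBetti 𝒳 (2 * p) →ₗ[ℂ] complexBetti 𝒳 (2 * p),
      IsAlgebraicCorrespondence N N 𝒳 𝒳 e ∧
      (∀ w, complexBetti.map (fiberι f t) (2 * p) (e w) = complexBetti.map (fiberι f t) (2 * p) w) ∧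
      (∀ w, complexBetti.map (fiberι f t) (2 * p) w = 0 → e w = 0) ∧
      (∀ w, e w ∈ algebraicClasses 𝒳 p) := by
  obtain rfl : N = n + m := dim_total_eq_add hS hf h𝒳
  have hY := hf.isSmoothProjective t
  haveI : Module.Finite ℂ (complexBetti (fiberOver f t) (2 * p)) := finite_complexBetti hY _
  haveI : Module.Finite ℂ (complexBetti (fiberOver f t) (2 * q)) := finite_complexBetti hY _
  haveI : Module.Finite ℂ (complexBetti 𝒳 (2 * p)) := finite_complexBetti h𝒳 _
  letI := hY.chartedSpace
  haveI := ComplexPoints.compactSpace_of_isSmoothProjective hY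
  haveI := ComplexPoints.t2Space_of_isSmoothProjective hY
  -- degrees
  have hab : 2 * q + 2 * (n + m) = 2 * (q + m) + 2 * n := by ring
  have hk : 2 * q + 2 * p = 2 * n := by omega
  have hbk : 2 * (q + m) + 2 * p = 2 * (n + m) := by omega
  have hak : 2 * p + 2 * (q + m) = 2 * (n + m) := by omega
  -- the restriction, the Gysin morphism, the pairings
  set r := (complexBetti.map (fiberι f t) (2 * p)).hom with hr
  set G := complexGysin complexOrientationFamily hY h𝒳 (fiberι f t) hab with hG
  -- the trace functional of part XIV-a is a multiple of `⟨-, [𝒳(ℂ)]⟩`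
  obtain ⟨τ, hτ0, hT⟩ := exists_crossTrace h𝒳 h𝒳
  obtain ⟨c', hc'⟩ := exists_eq_mul_of_forall_eq_zero τ hτ0
    ((kroneckerPairing ℂ ℂ (ComplexPoints 𝒳) (2 * (n + m))).flip (complexOrientationFamily h𝒳).fundamentalClass)
  -- transposition on `𝒳`: `⟨c ∪ z, [𝒳]⟩ = ⟨z ∪ c, [𝒳]⟩` in even degrees
  have hflip : ∀ (c : complexBetti 𝒳 (2 * p)) (z : complexBetti 𝒳 (2 * (q + m))),
      cupPairing (complexOrientationFamily h𝒳) hak c z = cupPairing (complexOrientationFamily h𝒳) hbk z c := by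
    intro c z
    have h := LinearMap.congr_fun (LinearMap.congr_fun
      (cupPairing_flip (cupProduct_gradedComm_holds ℂ (ComplexPoints 𝒳)) (complexOrientationFamily h𝒳) hbk hak) c) z
    rw [LinearMap.flip_apply, LinearMap.smul_apply, LinearMap.smul_apply,
      Even.neg_one_pow ⟨2 * (q + m) * p, by ring⟩, one_smul] at h
    exact h.symm
  -- the coefficient `τ(c ∪ c' • G w) = ⟨w ∪ j_t^* c, [X_t]⟩`
  have hcoef : ∀ (c : complexBetti 𝒳 (2 * p)) (w : complexBetti (fiberOver f t) (2 * q)),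
      τ (cupProduct hak c (c' • G w)) = cupPairing (complexOrientationFamily hY) hk w (r c) := by
    intro c w
    rw [map_smul, map_smul, smul_eq_mul, ← hc', LinearMap.flip_apply, ← cupPairing_apply, hflip, hG,
      cupPairing_complexGysin_complexOrientationFamily (fiberι f t) h𝒳 hY hab hk hbk w c]
  -- a basis of the invariants and algebraic lifts of it (A)
  set I : Submodule ℂ (complexBetti (fiberOver f t) (2 * p)) := LinearMap.range r with hI
  let b := Module.finBasis ℂ I
  have hx : ∀ i, ∃ x ∈ algebraicClasses 𝒳 p, r x = (b i : complexBetti (fiberOver f t) (2 * p)) := fun i ↦ by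
    obtain ⟨x, hx, hxr⟩ := Submodule.mem_map.1 (hA (b i).2)
    exact ⟨x, hx, hxr⟩
  choose x hxalg hxr using hx
  -- the dual functionals, extended to `H^{2p}(X_t)` and represented by Poincaré duality on `X_t(ℂ)`
  have hw : ∀ i, ∃ w' : complexBetti (fiberOver f t) (2 * q),
      ∀ v : I, cupPairing (complexOrientationFamily hY) hk w' (v : complexBetti (fiberOver f t) (2 * p)) = b.coord i v := by
    intro i
    obtain ⟨ψ, hψ⟩ := LinearMap.exists_extend (b.coord i)
    have hPerf : (cupPairing (complexOrientationFamily hY) hk).IsPerfPair := isPerfPair_cupPairing_of_field_holds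
    obtain ⟨w', hw'⟩ := (LinearMap.IsPerfPair.bijective_left (cupPairing (complexOrientationFamily hY) hk)).2 ψ
    refine ⟨w', fun v ↦ ?_⟩
    rw [hw', ← hψ, LinearMap.comp_apply, Submodule.subtype_apply]
  choose w' hw' using hw
  -- their invariant components along `H^{2q}(X_t) = Im j_t^* ⊕ ker j_{t*}` (part XXVI-a)
  have hdec : ∀ i, ∃ w ∈ LinearMap.range (complexBetti.map (fiberι f t) (2 * q)).hom, ∃ k ∈ LinearMap.ker G, w + k = w' i := by
    intro i
    have htop : w' i ∈ LinearMap.range (complexBetti.map (fiberι f t) (2 * q)).hom ⊔ LinearMap.ker G := by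
      rw [(isCompl_range_map_fiberι_ker_complexGysin hS hf h𝒳 hab t).sup_eq_top]
      exact Submodule.mem_top
    exact Submodule.mem_sup.1 htop
  choose w hwr k hk0 hwk using hdec
  -- the invariant components pair with the invariants as the dual basis does
  have hpair : ∀ (i) (c : complexBetti 𝒳 (2 * p)),
      cupPairing (complexOrientationFamily hY) hk (w i) (r c) = b.coord i (LinearMap.rangeRestrict r c) := by
    intro i c
    have hkc : cupPairing (complexOrientationFamily hY) hk (k i) (r c) = 0 := by
      rw [hr, ← cupPairing_complexGysin_complexOrientationFamily (fiberι f t) h𝒳 hY hab hk hbk (k i) c, ← hG,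
        LinearMap.mem_ker.1 (hk0 i), map_zero, LinearMap.zero_apply]
    have hsum : w i = w' i - k i := eq_sub_of_add_eq (hwk i)
    rw [hsum, map_sub, LinearMap.sub_apply, hkc, sub_zero]
    exact hw' i (LinearMap.rangeRestrict r c)
  -- the classes `c' • j_{t*} wᵢ` are algebraic (B)
  have hyalg : ∀ i, c' • G (w i) ∈ algebraicClasses 𝒳 (q + m) := fun i ↦
    Submodule.smul_mem _ _ (complexGysin_mem_algebraicClasses_of_mem_algebraicClasses complexOrientationFamily hY h𝒳
      (fiberι f t) hab (hB (hwr i)))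
  -- the algebraic correspondence of part XIV-a and its action
  obtain ⟨T, hTalg, hTc⟩ := hT hak (show p ≤ n + m by omega) _ x (fun i ↦ c' • G (w i)) hxalg hyalg
  have key : ∀ c, T c = ∑ i, cupPairing (complexOrientationFamily hY) hk (w i) (r c) • x i := by
    intro c
    rw [hTc c]
    exact Finset.sum_congr rfl fun i _ ↦ by rw [hcoef]
  refine ⟨T, hTalg, fun c ↦ ?_, fun c hc ↦ ?_, fun c ↦ ?_⟩
  · -- (π): `j_t^*(T c) = ∑ᵢ ψᵢ(j_t^* c) • xᵢ|_{X_t} = j_t^* c`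
    change r (T c) = r c
    rw [key, map_sum]
    simp_rw [map_smul, hxr, hpair, Module.Basis.coord_apply]
    have h := congrArg (Submodule.subtype I) (b.sum_repr (LinearMap.rangeRestrict r c))
    rw [map_sum] at h
    simp_rw [map_smul, Submodule.subtype_apply] at h
    rw [h]
    rfl
  · -- (κ)
    have hc' : r c = 0 := hc
    rw [key]
    simp_rw [hc', map_zero, zero_smul, Finset.sum_const_zero]
  · -- algebraic image
    rw [key]
    exact Submodule.sum_mem _ fun i _ ↦ Submodule.smul_mem _ _ (hxalg i)

/-! ## §3 The converse, and the reading for every idempotent -/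

/-- **Converse (no hypothesis)**: an endomorphism `e` with `j_t^* ∘ e = j_t^*` and algebraic image makes every invariant class of degree
`2p` the restriction of an algebraic class (`j_t^* c = j_t^*(e c)`). [cite: Milne2020HodgeClassesAV, proof of Prop. 1 (p. 7)] -/
theorem range_le_map_of_exists_lerayIdempotent (t : ComplexPoints S) {p : ℕ}
    (h : ∃ e : complexBetti 𝒳 (2 * p) →ₗ[ℂ] complexBetti 𝒳 (2 * p),
      (∀ w, complexBetti.map (fiberι f t) (2 * p) (e w) = complexBetti.map (fiberι f t) (2 * p) w) ∧
      (∀ w, e w ∈ algebraicClasses 𝒳 p)) :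
    LinearMap.range (complexBetti.map (fiberι f t) (2 * p)).hom ≤
      (algebraicClasses 𝒳 p).map (complexBetti.map (fiberι f t) (2 * p)).hom := by
  obtain ⟨e, hπ, halg⟩ := h
  rintro _ ⟨c, rfl⟩
  exact Submodule.mem_map.2 ⟨e c, halg c, hπ c⟩

/-- **[every invariant class of degree `2p` lifts to an algebraic class] ⟺ [there is an algebraic Leray idempotent at `(t, 2p)` with
algebraic image]**, granted that the invariant classes of the complementary degree `2q` are algebraic on the fibre (B).
[cite: Milne2020HodgeClassesAV, proof of Prop. 1 (pp. 7–8)] [cite: DeningerMurre1991, Thm. 3.1] -/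
theorem range_le_map_iff_exists_lerayIdempotent (hS : IsSmoothProjective m S) (hf : IsSmoothProjectiveFamily f n)
    (h𝒳 : IsSmoothProjective N 𝒳) (t : ComplexPoints S) {p q : ℕ} (hpq : p + q = n)
    (hB : LinearMap.range (complexBetti.map (fiberι f t) (2 * q)).hom ≤ algebraicClasses (fiberOver f t) q) :
    LinearMap.range (complexBetti.map (fiberι f t) (2 * p)).hom ≤
        (algebraicClasses 𝒳 p).map (complexBetti.map (fiberι f t) (2 * p)).hom ↔
      ∃ e : complexBetti 𝒳 (2 * p) →ₗ[ℂ] complexBetti 𝒳 (2 * p),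
        IsAlgebraicCorrespondence N N 𝒳 𝒳 e ∧
        (∀ w, complexBetti.map (fiberι f t) (2 * p) (e w) = complexBetti.map (fiberι f t) (2 * p) w) ∧
        (∀ w, complexBetti.map (fiberι f t) (2 * p) w = 0 → e w = 0) ∧
        (∀ w, e w ∈ algebraicClasses 𝒳 p) :=
  ⟨fun hA ↦ exists_lerayIdempotent_of_range_le_map hS hf h𝒳 t hpq hA hB,
    fun ⟨e, _, hπ, _, halg⟩ ↦ range_le_map_of_exists_lerayIdempotent t ⟨e, hπ, halg⟩⟩

/-- **In the habitat the reading holds for EVERY idempotent**: if some `e₀` with (π) has algebraic image, then every `e` at `(t, 2p)`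
preserving algebraic classes (e.g. (Π1)) and with (κ) has algebraic image: `e y = e(e₀ y) + e(y − e₀ y)` and `y − e₀ y ∈ ker j_t^*`.
[cite: DeningerMurre1991, Thm. 3.1 and Cor. 3.2] [cite: VoisinHodgeII2003, §9.2.4 Prop. 9.21] -/
theorem forall_mem_algebraicClasses_of_exists_lerayIdempotent (t : ComplexPoints S) {p : ℕ}
    (e₀ e : complexBetti 𝒳 (2 * p) →ₗ[ℂ] complexBetti 𝒳 (2 * p))
    (hπ₀ : ∀ w, complexBetti.map (fiberι f t) (2 * p) (e₀ w) = complexBetti.map (fiberι f t) (2 * p) w)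
    (halg₀ : ∀ w, e₀ w ∈ algebraicClasses 𝒳 p)
    (he : ∀ y ∈ algebraicClasses 𝒳 p, e y ∈ algebraicClasses 𝒳 p)
    (hκ : ∀ w, complexBetti.map (fiberι f t) (2 * p) w = 0 → e w = 0) (y : complexBetti 𝒳 (2 * p)) :
    e y ∈ algebraicClasses 𝒳 p := by
  have hdiff : e (y - e₀ y) = 0 := hκ _ (by rw [map_sub, hπ₀, sub_self])
  rw [show y = e₀ y + (y - e₀ y) by abel, map_add, hdiff, add_zero]
  exact he _ (halg₀ y)

/-! ## §4 The datum does not depend on the point -/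

/-- **`ker j_t^* = ker j_s^*`** for any two points of the (connected, smooth projective) base: a class dying on `X_t` is killed by
`j_{t*} j_t^*`, hence dies on every fibre (Deligne's kernel identity, a tree theorem: `restrict_eq_zero_of_complexGysin_eq_zero`).
[cite: DeligneHodgeII1971, Thm. 4.1.1 and Cor. 4.1.2] [cite: VoisinHodgeII2003, §4.3.1 Thm. 4.18] -/
theorem map_fiberι_eq_zero_iff_of_points (hS : IsSmoothProjective m S) (hf : IsSmoothProjectiveFamily f n)
    (h𝒳 : IsSmoothProjective N 𝒳) {k : ℕ} (t s : ComplexPoints S) (W : complexBetti 𝒳 k) :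
    complexBetti.map (fiberι f t) k W = 0 ↔ complexBetti.map (fiberι f s) k W = 0 := by
  obtain rfl : N = n + m := dim_total_eq_add hS hf h𝒳
  have hkb : k + 2 * (n + m) = (k + 2 * m) + 2 * n := by ring
  constructor
  · intro h
    exact restrict_eq_zero_of_complexGysin_eq_zero hS hf h𝒳 hkb t s W (by rw [h, map_zero])
  · intro h
    exact restrict_eq_zero_of_complexGysin_eq_zero hS hf h𝒳 hkb s t W (by rw [h, map_zero])

/-- **A Leray idempotent at `t` is a Leray idempotent at every point `s`**: (π) and (κ) at `t` imply (π) and (κ) at `s` (both are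
statements about `ker j_t^* = ker j_s^*`). Hence "at CM points" in the bracket `CMLerayIdempotentC[]` only selects the pencils; the
idempotent is a datum of (pencil, degree). [cite: DeligneHodgeII1971, Thm. 4.1.1] [cite: DeningerMurre1991, Cor. 3.2] -/
theorem leray_at_of_at (hS : IsSmoothProjective m S) (hf : IsSmoothProjectiveFamily f n) (h𝒳 : IsSmoothProjective N 𝒳)
    {k : ℕ} (t s : ComplexPoints S) (e : complexBetti 𝒳 k →ₗ[ℂ] complexBetti 𝒳 k)
    (hπ : ∀ w, complexBetti.map (fiberι f t) k (e w) = complexBetti.map (fiberι f t) k w)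
    (hκ : ∀ w, complexBetti.map (fiberι f t) k w = 0 → e w = 0) :
    (∀ w, complexBetti.map (fiberι f s) k (e w) = complexBetti.map (fiberι f s) k w) ∧
      (∀ w, complexBetti.map (fiberι f s) k w = 0 → e w = 0) := by
  refine ⟨fun w ↦ ?_, fun w hw ↦ hκ w ((map_fiberι_eq_zero_iff_of_points hS hf h𝒳 t s w).2 hw)⟩
  rw [← sub_eq_zero, ← map_sub]
  exact (map_fiberι_eq_zero_iff_of_points hS hf h𝒳 t s _).1 (by rw [map_sub, hπ, sub_self])

end Family

/-! ## §5 Compact abelian pencils: (L)_t(p) ⟺ an algebraic Leray idempotent with algebraic image -/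

section Pencil

variable {𝒳 S : SchemeOver ℂ} {d : ℕ} {f : 𝒳 ⟶ S}

/-- **Pencil form of §2**: on a compact pencil of abelian `d`-folds, `p + q = d`, (A) and (B) give `e` with (Π1)
(`IsAlgebraicCorrespondence (d+1) (d+1)`), (π), (κ) and algebraic image. [cite: Milne2020HodgeClassesAV, proof of Prop. 1 (pp. 7–8)]
[cite: DeningerMurre1991, Thm. 3.1] -/
theorem exists_lerayIdempotentC_of_range_le_map (hf : IsCompactAbelianPencil f d) (t : ComplexPoints S) {p q : ℕ}
    (hpq : p + q = d)
    (hA : LinearMap.range (complexBetti.map (fiberι f t) (2 * p)).hom ≤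
      (algebraicClasses 𝒳 p).map (complexBetti.map (fiberι f t) (2 * p)).hom)
    (hB : LinearMap.range (complexBetti.map (fiberι f t) (2 * q)).hom ≤ algebraicClasses (fiberOver f t) q) :
    ∃ e : complexBetti 𝒳 (2 * p) →ₗ[ℂ] complexBetti 𝒳 (2 * p),
      IsAlgebraicCorrespondence (d + 1) (d + 1) 𝒳 𝒳 e ∧
      (∀ w, complexBetti.map (fiberι f t) (2 * p) (e w) = complexBetti.map (fiberι f t) (2 * p) w) ∧
      (∀ w, complexBetti.map (fiberι f t) (2 * p) w = 0 → e w = 0) ∧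
      (∀ w, e w ∈ algebraicClasses 𝒳 p) :=
  exists_lerayIdempotent_of_range_le_map hf.isSmoothProjective_base hf.isSmoothProjectiveFamily hf.isSmoothProjective_total
    t hpq hA hB

/-- **(A) ⟹ (L)_t(p)** (no hypothesis): if every invariant class lifts to an algebraic class then a class with algebraic restriction
is algebraic modulo `ker j_t^*`. [cite: Milne2020HodgeClassesAV, proof of Prop. 1 (p. 7)] -/
theorem comap_le_sup_of_range_le_map (t : ComplexPoints S) {p : ℕ}
    (hA : LinearMap.range (complexBetti.map (fiberι f t) (2 * p)).hom ≤
      (algebraicClasses 𝒳 p).map (complexBetti.map (fiberι f t) (2 * p)).hom) :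
    (algebraicClasses (fiberOver f t) p).comap (complexBetti.map (fiberι f t) (2 * p)).hom ≤
      algebraicClasses 𝒳 p ⊔ LinearMap.ker (complexBetti.map (fiberι f t) (2 * p)).hom := by
  intro W _
  obtain ⟨y, hy, hyW⟩ := Submodule.mem_map.1 (hA (LinearMap.mem_range_self _ W))
  rw [show W = y + (W - y) by abel]
  refine Submodule.add_mem_sup hy ?_
  rw [LinearMap.mem_ker, map_sub, sub_eq_zero]
  exact hyW.symm

/-- **(L)_t(p) ⟹ (A) when the invariant classes of degree `2p` are algebraic on the fibre** (part XXI-a's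
`mem_map_algebraicClasses_of_comap_le_sup`, class by class). [cite: Milne2020HodgeClassesAV, Prop. 1 (p. 7)] -/
theorem range_le_map_of_comap_le_sup (hf : IsCompactAbelianPencil f d) (t : ComplexPoints S) {p : ℕ}
    (hI : LinearMap.range (complexBetti.map (fiberι f t) (2 * p)).hom ≤ algebraicClasses (fiberOver f t) p)
    (hL : (algebraicClasses (fiberOver f t) p).comap (complexBetti.map (fiberι f t) (2 * p)).hom ≤
      algebraicClasses 𝒳 p ⊔ LinearMap.ker (complexBetti.map (fiberι f t) (2 * p)).hom) :
    LinearMap.range (complexBetti.map (fiberι f t) (2 * p)).hom ≤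
      (algebraicClasses 𝒳 p).map (complexBetti.map (fiberι f t) (2 * p)).hom :=
  fun _ hξ ↦ mem_map_algebraicClasses_of_comap_le_sup hf t hL (hI hξ) hξ

/-- **HEADLINE — `(L)_t(p) ⟺ [∃ algebraic Leray idempotent at (t, 2p) with algebraic image]`, at a point where the invariant classes of
degrees `2p` and `2q = 2d − 2p` are algebraic on the fibre.** In this habitat the bracket `CMLerayIdempotentC[]` is not an extra
hypothesis: the André-axis candidate at `(t, p)` IS the find-the-cycles statement "an algebraic `(d+1)`-cycle on `𝒳 × 𝒳` acting on
`H^{2p}(𝒳)` with `j_t^* e = j_t^*`, `e|ker j_t^* = 0`, whose image is spanned by algebraic `p`-cycles of `𝒳`".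
[cite: Milne2020HodgeClassesAV, proof of Prop. 1 (pp. 7–8)] [cite: DeningerMurre1991, Thm. 3.1 and Cor. 3.2] [cite: Andre1996Motifs, §5.1 (p. 25) and Remarque 2 (p. 33)] -/
theorem comap_le_sup_iff_exists_lerayIdempotentC (hf : IsCompactAbelianPencil f d) (t : ComplexPoints S) {p q : ℕ}
    (hpq : p + q = d)
    (hIp : LinearMap.range (complexBetti.map (fiberι f t) (2 * p)).hom ≤ algebraicClasses (fiberOver f t) p)
    (hIq : LinearMap.range (complexBetti.map (fiberι f t) (2 * q)).hom ≤ algebraicClasses (fiberOver f t) q) :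
    (algebraicClasses (fiberOver f t) p).comap (complexBetti.map (fiberι f t) (2 * p)).hom ≤
        algebraicClasses 𝒳 p ⊔ LinearMap.ker (complexBetti.map (fiberι f t) (2 * p)).hom ↔
      ∃ e : complexBetti 𝒳 (2 * p) →ₗ[ℂ] complexBetti 𝒳 (2 * p),
        IsAlgebraicCorrespondence (d + 1) (d + 1) 𝒳 𝒳 e ∧
        (∀ w, complexBetti.map (fiberι f t) (2 * p) (e w) = complexBetti.map (fiberι f t) (2 * p) w) ∧
        (∀ w, complexBetti.map (fiberι f t) (2 * p) w = 0 → e w = 0) ∧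
        (∀ w, e w ∈ algebraicClasses 𝒳 p) :=
  ⟨fun hL ↦ exists_lerayIdempotentC_of_range_le_map hf t hpq (range_le_map_of_comap_le_sup hf t hIp hL) hIq,
    fun ⟨e, _, hπ, _, halg⟩ ↦ comap_le_sup_of_range_le_map t (range_le_map_of_exists_lerayIdempotent t ⟨e, hπ, halg⟩)⟩

/-- **The same with part XXVII-e's reading: `(L)_t(p) ⟺ ∃ e` with (Π1), (π), (κ) such that every `e`-fixed `(p,p)`-class with rational
restriction is algebraic** (habitat as above; ⟸ is part XXVII-e and needs no habitat clause). So, where the invariants of the CM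
fibre are algebraic, "`CMLerayIdempotentC[] ∧ CMIdempotentHodgeC[]`" at `(t, p)` is EQUIVALENT to (L)_t(p), not merely sufficient.
[cite: Milne2020HodgeClassesAV, proof of Prop. 1 (pp. 7–8)] [cite: DeningerMurre1991, Thm. 3.1] -/
theorem comap_le_sup_iff_exists_lerayIdempotentC_hodge (hf : IsCompactAbelianPencil f d) (t : ComplexPoints S) {p q : ℕ}
    (hpq : p + q = d)
    (hIp : LinearMap.range (complexBetti.map (fiberι f t) (2 * p)).hom ≤ algebraicClasses (fiberOver f t) p)
    (hIq : LinearMap.range (complexBetti.map (fiberι f t) (2 * q)).hom ≤ algebraicClasses (fiberOver f t) q) :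
    (algebraicClasses (fiberOver f t) p).comap (complexBetti.map (fiberι f t) (2 * p)).hom ≤
        algebraicClasses 𝒳 p ⊔ LinearMap.ker (complexBetti.map (fiberι f t) (2 * p)).hom ↔
      ∃ e : complexBetti 𝒳 (2 * p) →ₗ[ℂ] complexBetti 𝒳 (2 * p),
        IsAlgebraicCorrespondence (d + 1) (d + 1) 𝒳 𝒳 e ∧
        (∀ w, complexBetti.map (fiberι f t) (2 * p) (e w) = complexBetti.map (fiberι f t) (2 * p) w) ∧
        (∀ w, complexBetti.map (fiberι f t) (2 * p) w = 0 → e w = 0) ∧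
        ∀ y₀ : complexBetti 𝒳 (2 * p), e y₀ = y₀ → IsRationalClass (complexBetti.map (fiberι f t) (2 * p) y₀) →
          IsOfHodgeType (d + 1) 𝒳 (2 * p) p p y₀ → y₀ ∈ algebraicClasses 𝒳 p := by
  refine ⟨fun hL ↦ ?_, fun ⟨e, halg, hπ, hκ, h⟩ ↦ comap_le_sup_of_forall_fixed_fibreRational_hodge_mem hf t e halg hπ hκ h⟩
  obtain ⟨e, halg, hπ, hκ, him⟩ := (comap_le_sup_iff_exists_lerayIdempotentC hf t hpq hIp hIq).1 hL
  exact ⟨e, halg, hπ, hκ, fun y₀ hy₀ _ _ ↦ hy₀ ▸ him y₀⟩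

/-- **Pencil form of §4**: a Leray idempotent at one point of a compact abelian pencil is one at every point. [cite: DeligneHodgeII1971, Thm. 4.1.1] -/
theorem leray_at_of_at' (hf : IsCompactAbelianPencil f d) {k : ℕ} (t s : ComplexPoints S)
    (e : complexBetti 𝒳 k →ₗ[ℂ] complexBetti 𝒳 k)
    (hπ : ∀ w, complexBetti.map (fiberι f t) k (e w) = complexBetti.map (fiberι f t) k w)
    (hκ : ∀ w, complexBetti.map (fiberι f t) k w = 0 → e w = 0) :
    (∀ w, complexBetti.map (fiberι f s) k (e w) = complexBetti.map (fiberι f s) k w) ∧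
      (∀ w, complexBetti.map (fiberι f s) k w = 0 → e w = 0) :=
  leray_at_of_at hf.isSmoothProjective_base hf.isSmoothProjectiveFamily hf.isSmoothProjective_total t s e hπ hκ

end Pencil

end Summit.HodgeConjecture.HodgeConjecture.Ring2.AbelianAll

end
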